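import Summits.AtomisticToContinuum.FouriersLaw.Theses.OddSectorIrreversibility
import Summits.AtomisticToContinuum.FouriersLaw.Theorems.OddSectorIrreversibilityBoundedResponse
import Summits.AtomisticToContinuum.FouriersLaw.Theorems.OddSectorIrreversibilityCorrectorPairingGreenKubo

/-!
# `CorrectorTheory` forces a nonnegative response: `0 ≤ D_N` (support for stmt-AtomisticToContinuum-10924)

Route `OddSectorIrreversibility` (sub-problem `FouriersLaw`). The closing argument of `WitnessGlue`
for the shared item `BoundedResponse` ends in the two-sided shape `0 ≤ D_N ≤ C`
(`bddAbove_range_abs_of_eventually_nonneg_le`), the lower bound being "`0 ≤ D_N` by the energy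
identity". This file makes that lower bound a theorem, conditional only on the fixed-`N` support
item `CorrectorTheory` (stmt-AtomisticToContinuum-14071): for the Kubo corrector `u` of conjunct A,

  `γT (‖∂_{p_0} u‖² + ‖∂_{p_{N-1}} u‖²)_{μ_T} = ⟨u, J⟩_{μ_T}`       (A(6), tap energy identity)
  `⟨u, J⟩_{μ_T} = Z ∫_{(0,∞)} c_N`                                 (`pinnedChain_integral_corrector_mul_withDensity`, A(2)+A(4)+B)
  `(N-1) T² D_N = ∫_{(0,∞)} c_N`                                    (B, Kubo identity)

so `Z (N-1) T² D_N ≥ 0`, i.e. `D_N ≥ 0` for `N ≥ 2` (`Z > 0`); for `N ≤ 1` the response coefficient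
is `0` outright (`responseCoeff_eq_zero_of_le_one`).

* `response_nonneg_of_correctorTheory` — `CorrectorTheory →` (under weak-NESS uniqueness, along any
  steady-state family, `T > 0`, any `N`) every response coefficient `D` of clause (ii) is `≥ 0`.
* `boundedResponse_of_correctorTheory_of_eventually_le` — hence, given `CorrectorTheory`, an
  eventual UPPER bound `D_N ≤ C` along every family already gives `BoundedResponse`.

No definitions, no named facts; conditional on the open item 14071; nothing here closes an item.
-/

noncomputable section

open MeasureTheory ProbabilityTheory Filter Topology Set
open scoped NNReal ENNReal

namespace Summit.AtomisticToContinuum.FouriersLaw.Theorems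

open Literature.MathematicalPhysics.KineticTheory.HeatConduction
open Literature.MathematicalPhysics.KineticTheory OscillatorChain
open Summit.AtomisticToContinuum.FouriersLaw.Theses

/-- **`CorrectorTheory ⟹ 0 ≤ D_N`.** Under weak-NESS uniqueness, along any steady-state family of
`pinnedChain ω₂ lam β γ` (all parameters `> 0`) and at any `T > 0`, every finite-`N` response
coefficient `D = lim_{δ→0,δ≠0} totalCurrent(μ N (T+δ/2) (T-δ/2))/δ` is nonnegative, given the
fixed-`N` corrector calculus `CorrectorTheory`: the tap energy identity A(6) makes `⟨u, J⟩_{μ_T}` a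
sum of squares, the pairing identity (A(2), A(4), B and Fubini) and the Kubo identity B turn it into
`Z (N-1) T² D`. [folklore] -/
theorem response_nonneg_of_correctorTheory (hCT : OddSectorIrreversibility.CorrectorTheory)
    {ω₂ lam β γ : ℝ} (hω : 0 < ω₂) (hl : 0 < lam) (hβ : 0 < β) (hγ : 0 < γ)
    (hU : ∀ (N : ℕ) (T_L T_R : ℝ), 0 < T_L → 0 < T_R → ∀ μ ν : Measure (PhaseSpace N),
      (pinnedChain ω₂ lam β γ).IsSteadyState N T_L T_R μ →
        (pinnedChain ω₂ lam β γ).IsSteadyState N T_L T_R ν → μ = ν)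
    (μ : (N : ℕ) → ℝ → ℝ → Measure (PhaseSpace N))
    (hμ : ∀ (N : ℕ) (T_L T_R : ℝ), 0 < T_L → 0 < T_R →
      (pinnedChain ω₂ lam β γ).IsSteadyState N T_L T_R (μ N T_L T_R))
    {T : ℝ} (hT : 0 < T) (N : ℕ) {D : ℝ}
    (hD : Tendsto (fun δ : ℝ =>
        (pinnedChain ω₂ lam β γ).totalCurrent (μ N (T + δ / 2) (T - δ / 2)) / δ)
      (𝓝[≠] 0) (𝓝 D)) :
    0 ≤ D := by
  rcases Nat.lt_or_ge N 2 with hN2 | hN2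
  · exact (responseCoeff_eq_zero_of_le_one (pinnedChain ω₂ lam β γ) (by omega) (μ N) hD).ge
  · have hN : 0 < N := by omega
    obtain ⟨u, -, hu2, -, h4, -, h6, -⟩ := hCT.1 ω₂ lam β γ hω hl hβ hγ T hT N
    obtain ⟨hcI, hK⟩ := hCT.2 ω₂ lam β γ hω hl hβ hγ hU μ hμ T hT N D hD
    simp only [] at hu2 h4 h6 hcI hK
    have hpair := (pinnedChain_integral_corrector_mul_withDensity hω hl.le hβ hγ hN hT hu2 h4 hcI).2
    have h6' := h6 ⟨0, by omega⟩ ⟨N - 1, by omega⟩ rfl rfl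
    -- `⟨u, J⟩_{μ_T}` is a nonnegative combination of squares
    have hnn : 0 ≤ ∫ x, u x * (∑ i : Fin N, (pinnedChain ω₂ lam β γ).bondCurrent N i x)
        ∂(volume.withDensity fun x : PhaseSpace N => ENNReal.ofReal
          (Real.exp (-((pinnedChain ω₂ lam β γ).hamiltonian N x) / T))) := by
      rw [← h6']
      have h1 := integral_nonneg (μ := volume.withDensity fun x : PhaseSpace N => ENNReal.ofReal
          (Real.exp (-((pinnedChain ω₂ lam β γ).hamiltonian N x) / T)))
        (f := fun x => (partialP (⟨0, by omega⟩ : Fin N) u x) ^ 2) fun x => sq_nonneg _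
      have h2 := integral_nonneg (μ := volume.withDensity fun x : PhaseSpace N => ENNReal.ofReal
          (Real.exp (-((pinnedChain ω₂ lam β γ).hamiltonian N x) / T)))
        (f := fun x => (partialP (⟨N - 1, by omega⟩ : Fin N) u x) ^ 2) fun x => sq_nonneg _
      have hγT : 0 ≤ γ * T := by positivity
      exact mul_nonneg hγT (add_nonneg h1 h2)
    rw [hpair, ← hK] at hnn
    -- `Z > 0`, `N - 1 > 0`, `T² > 0`
    have hZ : 0 < ∫ x : PhaseSpace N,
        Real.exp (-((pinnedChain ω₂ lam β γ).hamiltonian N x) / T) :=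
      integral_exp_pos (pinnedChain_integrable_gibbsDensity hω hl.le hβ.le γ N hT)
    have hN1 : (0 : ℝ) < (N : ℝ) - 1 := by
      have : (2 : ℝ) ≤ N := by exact_mod_cast hN2
      linarith
    have hT2 : (0 : ℝ) < T ^ 2 := by positivity
    have hprod : 0 ≤ ((N : ℝ) - 1) * T ^ 2 * D := (mul_nonneg_iff_of_pos_left hZ).1 hnn
    exact (mul_nonneg_iff_of_pos_left (mul_pos hN1 hT2)).1 hprod

/-- **Given `CorrectorTheory`, an eventual upper bound suffices.** If, at every admissible parameter
point with unique weak steady states, along every steady-state family and at every `T > 0` the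
response coefficients satisfy `D_N ≤ C` for all large `N`, then `BoundedResponse` — the lower bound
`0 ≤ D_N` is `response_nonneg_of_correctorTheory`. [folklore] -/
theorem boundedResponse_of_correctorTheory_of_eventually_le
    (hCT : OddSectorIrreversibility.CorrectorTheory)
    (hup : ∀ ω₂ lam β γ : ℝ, 0 < ω₂ → 0 < lam → 0 < β → 0 < γ →
      (∀ (N : ℕ) (T_L T_R : ℝ), 0 < T_L → 0 < T_R → ∀ μ ν : Measure (PhaseSpace N),
        (pinnedChain ω₂ lam β γ).IsSteadyState N T_L T_R μ →
          (pinnedChain ω₂ lam β γ).IsSteadyState N T_L T_R ν → μ = ν) →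
      ∀ μ : (N : ℕ) → ℝ → ℝ → Measure (PhaseSpace N),
        (∀ (N : ℕ) (T_L T_R : ℝ), 0 < T_L → 0 < T_R →
          (pinnedChain ω₂ lam β γ).IsSteadyState N T_L T_R (μ N T_L T_R)) →
        ∀ T : ℝ, 0 < T → ∀ D : ℕ → ℝ,
          (∀ N : ℕ, Tendsto (fun δ : ℝ =>
              (pinnedChain ω₂ lam β γ).totalCurrent (μ N (T + δ / 2) (T - δ / 2)) / δ)
            (𝓝[≠] 0) (𝓝 (D N))) →
          ∃ C : ℝ, ∀ᶠ N in atTop, D N ≤ C) :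
    OddSectorIrreversibility.BoundedResponse := by
  intro ω₂ lam β γ hω hl hβ hγ hU μ hμ T hT D hD
  obtain ⟨C, hC⟩ := hup ω₂ lam β γ hω hl hβ hγ hU μ hμ T hT D hD
  exact bddAbove_range_abs_of_eventually_nonneg_le
    (Eventually.of_forall fun N => response_nonneg_of_correctorTheory hCT hω hl hβ hγ hU μ hμ hT N (hD N))
    hC

end Summit.AtomisticToContinuum.FouriersLaw.Theorems

end
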